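import Literature.Geometry.Riemannian.MCFTranslationInvariance
import HarnessLib

/-!
# Parabolic scaling of mean curvature flow: `(x, t) ↦ (c x, c² t)`

Topic `Literature/Geometry/Riemannian`. The basic symmetry of mean curvature flow (used for all
blow-up / tangent-flow arguments): for `c > 0`, if `t ↦ F(t, ·)` moves by mean curvature then so
does `t ↦ c F(t/c², ·)`. In the tree's vocabulary (`IsClassicalMCF`, `IsWeakSetFlowIn`,
`levelSetFlow` of `MeanConvexLevelSetFlow.lean`, Euclidean ambient space):

* homotheties act on immersed hypersurfaces: `d(cf) = c df` (`mfderiv_const_smul_apply`), the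
  induced form scales by `c²` (`inducedBilin_const_smul`), unit normals are unchanged
  (`isUnitNormal_const_smul`), `K` scales by `c` and **`H` by `c⁻¹`**
  (`secondFundamentalForm_const_smul`, `meanCurvature_const_smul`; flat formulas of
  `EuclideanHypersurfaceContact.lean`, frames rescaled by `c⁻¹`);
* `IsClassicalMCF.parabolicSmul` — **classical flows rescale parabolically** (velocity
  `c · c⁻² ∂ₜF = -(c⁻¹H) ν`);
* `IsWeakSetFlowIn.parabolicSmul` — so do weak set flows (test flows rescale by `c⁻¹`);
* `levelSetFlow_image_smul` — **`F_t(c K₀) = c F_{t/c²}(K₀)`**; `levelSetFlow_cone` — cones have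
  self-similar level set flows.

Everything is PROVED; no definitions, no named facts.

## References

* C. Mantegazza, *Lecture Notes on Mean Curvature Flow* (2011), §1.1 (invariance under parabolic
  rescaling). [Mantegazza2011]
* B. White, J. Amer. Math. Soc. 13 (2000), §2. [White2000]
* O. Hershkovits, B. White, Comm. Pure Appl. Math. 73 (2020), Appendix, Def. 19.
  [HershkovitsWhite2019]
-/

noncomputable section

open Bundle Set Function Metric Module Filter
open scoped Manifold ContDiff Topology RealInnerProductSpace Pointwise

namespace Literature.Geometry.Riemannian

open Lorentzian Lorentzian.PseudoRiemannianMetric EuclideanHypersurface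

/-! ### Homotheties acting on immersed hypersurfaces of a Euclidean space -/

section Homothety

variable {E' : Type*} [NormedAddCommGroup E'] [NormedSpace ℝ E']
  {H' : Type*} [TopologicalSpace H'] {I' : ModelWithCorners ℝ E' H'}
  {N : Type*} [TopologicalSpace N] [ChartedSpace H' N]
  {V : Type*} [NormedAddCommGroup V] [InnerProductSpace ℝ V] (c : ℝ)

/-- The homothety `x ↦ c x` as a continuous linear map (local shorthand in statements:
`c • ContinuousLinearMap.id ℝ V`). Its differential action: `d(c f)_x w = c (df_x w)`. [folklore] -/
theorem mfderiv_const_smul_apply {f : N → V} {x : N} (hf : MDifferentiableAt I' 𝓘(ℝ, V) f x)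
    (w : TangentSpace I' x) :
    (mfderiv I' 𝓘(ℝ, V) (fun y ↦ c • f y) x : TangentSpace I' x →L[ℝ] V) w =
      (c • ContinuousLinearMap.id ℝ V) ((mfderiv I' 𝓘(ℝ, V) f x : TangentSpace I' x →L[ℝ] V) w) := by
  have h : HasMFDerivAt I' 𝓘(ℝ, V) (fun y ↦ (c • ContinuousLinearMap.id ℝ V) (f y)) x
      ((c • ContinuousLinearMap.id ℝ V).comp (mfderiv I' 𝓘(ℝ, V) f x : TangentSpace I' x →L[ℝ] V)) :=
    (c • ContinuousLinearMap.id ℝ V).hasFDerivAt.hasMFDerivAt.comp x hf.hasMFDerivAt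
  have h' : HasMFDerivAt I' 𝓘(ℝ, V) (fun y ↦ c • f y) x
      ((c • ContinuousLinearMap.id ℝ V).comp (mfderiv I' 𝓘(ℝ, V) f x : TangentSpace I' x →L[ℝ] V)) := h
  rw [h'.mfderiv]
  rfl

/-- `⟪c x, c y⟫ = c² ⟪x, y⟫` for the homothety. [folklore] -/
theorem inner_smulCLM_smulCLM (x y : V) :
    ⟪(c • ContinuousLinearMap.id ℝ V) x, (c • ContinuousLinearMap.id ℝ V) y⟫ = c ^ 2 * ⟪x, y⟫ := by
  simp only [FunLike.coe_smul, Pi.smul_apply, ContinuousLinearMap.id_apply, real_inner_smul_left,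
    real_inner_smul_right]
  ring

/-- `⟪x, c y⟫ = c ⟪x, y⟫` for the homothety. [folklore] -/
theorem inner_smulCLM_right (x y : V) :
    ⟪x, (c • ContinuousLinearMap.id ℝ V) y⟫ = c * ⟪x, y⟫ := by
  simp only [FunLike.coe_smul, Pi.smul_apply, ContinuousLinearMap.id_apply, real_inner_smul_right]

/-- The induced bilinear form of `c • f` is `c²` times that of `f`. [folklore] -/
theorem inducedBilin_const_smul {f : N → V} (hf : ContMDiff I' 𝓘(ℝ, V) 1 f) (y : N)
    (u w : TangentSpace I' y) :
    (euclideanMetric V).inducedBilin I' (fun y ↦ c • f y) y u w =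
      c ^ 2 * (euclideanMetric V).inducedBilin I' f y u w := by
  have hd : MDifferentiableAt I' 𝓘(ℝ, V) f y := (hf y).mdifferentiableAt one_ne_zero
  rw [inducedBilin_apply, inducedBilin_apply, euclideanMetric_apply, euclideanMetric_apply]
  have e₁ := mfderiv_const_smul_apply c hd u
  have e₂ := mfderiv_const_smul_apply c hd w
  change ⟪(mfderiv I' 𝓘(ℝ, V) (fun y ↦ c • f y) y : TangentSpace I' y →L[ℝ] V) u,
      (mfderiv I' 𝓘(ℝ, V) (fun y ↦ c • f y) y : TangentSpace I' y →L[ℝ] V) w⟫ =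
    c ^ 2 * ⟪(mfderiv I' 𝓘(ℝ, V) f y : TangentSpace I' y →L[ℝ] V) u,
      (mfderiv I' 𝓘(ℝ, V) f y : TangentSpace I' y →L[ℝ] V) w⟫
  rw [e₁, e₂]
  exact inner_smulCLM_smulCLM c _ _

/-- **A nonzero homothety maps spacelike immersions to spacelike immersions.** [folklore] -/
theorem isSpacelikeImmersion_const_smul (hc : c ≠ 0) {f : N → V}
    (hf : (euclideanMetric V).IsSpacelikeImmersion I' f) :
    (euclideanMetric V).IsSpacelikeImmersion I' (fun y ↦ c • f y) := by
  refine ⟨(c • ContinuousLinearMap.id ℝ V).contMDiff.comp hf.contMDiff, fun y w hw ↦ ?_⟩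
  rw [inducedBilin_const_smul c (hf.contMDiff.of_le (by simp)) y w w]
  exact mul_pos (by positivity) (hf.inducedBilin_pos y hw)

/-- **Homotheties preserve unit normals**: `ν` is a unit normal of `c • f`. [folklore] -/
theorem isUnitNormal_const_smul {f ν : N → V} (hf : ContMDiff I' 𝓘(ℝ, V) 1 f)
    (hν : (euclideanMetric V).IsUnitNormal I' f ν 1) :
    (euclideanMetric V).IsUnitNormal I' (fun y ↦ c • f y) ν 1 := by
  refine ⟨fun y w ↦ ?_, hν.val_self⟩
  have hd : MDifferentiableAt I' 𝓘(ℝ, V) f y := (hf y).mdifferentiableAt one_ne_zero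
  have h : ⟪ν y, (mfderiv I' 𝓘(ℝ, V) f y : TangentSpace I' y →L[ℝ] V) w⟫ = 0 := hν.isNormalTo y w
  have e := mfderiv_const_smul_apply c hd w
  change ⟪ν y, (mfderiv I' 𝓘(ℝ, V) (fun y ↦ c • f y) y : TangentSpace I' y →L[ℝ] V) w⟫ = 0
  rw [e]
  exact (inner_smulCLM_right c _ _).trans ((congrArg (fun r : ℝ ↦ c * r) h).trans (mul_zero c))

variable [FiniteDimensional ℝ E'] [I'.Boundaryless] [IsManifold I' ∞ N] [FiniteDimensional ℝ V]
  [(euclideanMetric V).HasLeviCivita]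

/-- **The second fundamental form scales linearly**: `K_{cf, ν} = c K_{f, ν}`. [folklore] -/
theorem secondFundamentalForm_const_smul {f ν : N → V} (hf : ContMDiff I' 𝓘(ℝ, V) ∞ f)
    (hν : ContMDiff I' 𝓘(ℝ, V) ∞ ν) (y : N) (u w : TangentSpace I' y) :
    (euclideanMetric V).secondFundamentalForm I' (fun y ↦ c • f y) ν y u w =
      c * (euclideanMetric V).secondFundamentalForm I' f ν y u w := by
  have hdf : MDifferentiableAt I' 𝓘(ℝ, V) f y := (hf y).mdifferentiableAt (by simp)
  have hf' : ContMDiff I' 𝓘(ℝ, V) ∞ (fun y ↦ c • f y) :=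
    (c • ContinuousLinearMap.id ℝ V).contMDiff.comp hf
  have h1 := secondFundamentalForm_eq_inner hf' hν y u w
  have h2 := secondFundamentalForm_eq_inner hf hν y u w
  rw [h1, h2, mfderiv_const_smul_apply c hdf w]
  exact inner_smulCLM_right c _ _

/-- **The mean curvature scales inversely**: `H_{cf, ν} = c⁻¹ H_{f, ν}` for `c ≠ 0` (the induced
metric scales by `c²`, so a `(cf)^*δ`-orthonormal frame is `c⁻¹` times an `f^*δ`-orthonormal
one, and `K` scales by `c`). [folklore] -/
theorem meanCurvature_const_smul (hc : c ≠ 0) {f ν : N → V}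
    (hpb : contMDiff_pullbackBilin 𝓘(ℝ, V) V I' N ∞)
    (hf : (euclideanMetric V).IsSpacelikeImmersion I' f)
    (hf' : (euclideanMetric V).IsSpacelikeImmersion I' (fun y ↦ c • f y))
    (hν : ContMDiff I' 𝓘(ℝ, V) ∞ ν) (y : N) :
    (euclideanMetric V).meanCurvature (fun y ↦ c • f y) hpb hf' ν y =
      c⁻¹ * (euclideanMetric V).meanCurvature f hpb hf ν y := by
  set g₁ := (euclideanMetric V).inducedMetric f hpb hf with hg₁
  set g₂ := (euclideanMetric V).inducedMetric (fun y ↦ c • f y) hpb hf' with hg₂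
  have hval : ∀ u w : TangentSpace I' y, g₂.val y u w = c ^ 2 * g₁.val y u w := fun u w ↦ by
    rw [hg₁, hg₂, inducedMetric_val, inducedMetric_val]
    exact inducedBilin_const_smul c (hf.contMDiff_self.of_le (by simp)) y u w
  have hpos : ∀ u : TangentSpace I' y, u ≠ 0 → 0 < g₁.val y u u :=
    fun u hu ↦ isRiemannian_inducedMetric _ _ hpb hf y u hu
  haveI : FiniteDimensional ℝ (TangentSpace I' y) := inferInstanceAs (FiniteDimensional ℝ E')
  obtain ⟨b, hb⟩ := g₁.exists_basis_isOrthonormalFrame hpos (m := finrank ℝ E') rfl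
  -- the rescaled frame `c⁻¹ b` is orthonormal for `g₂`
  have hunit : ∀ _ : Fin (finrank ℝ E'), IsUnit (c⁻¹ : ℝ) := fun _ ↦ (inv_ne_zero hc).isUnit
  set b' := b.isUnitSMul hunit with hb'def
  have hb'i : ∀ i, b' i = c⁻¹ • b i := fun i ↦ by rw [hb'def, Module.Basis.isUnitSMul_apply]
  have hb' : g₂.IsOrthonormalFrame y b' := by
    refine ⟨fun i ↦ ?_, fun i j hij ↦ ?_⟩
    · rw [hb'i, hval, map_smul, map_smul, FunLike.coe_smul, Pi.smul_apply, smul_eq_mul, smul_eq_mul,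
        hb.1 i]
      field_simp
    · rw [hb'i, hb'i, hval, map_smul, map_smul, FunLike.coe_smul, Pi.smul_apply, smul_eq_mul,
        smul_eq_mul, hb.2 i j hij]
      ring
  rw [meanCurvature, meanCurvature, g₂.trace_eq_sum_of_isOrthonormalFrame b' hb',
    g₁.trace_eq_sum_of_isOrthonormalFrame b hb, Finset.mul_sum]
  refine Finset.sum_congr rfl fun i _ ↦ ?_
  rw [hb'i, map_smul, map_smul, LinearMap.smul_apply, smul_eq_mul, smul_eq_mul,
    secondFundamentalForm_const_smul c hf.contMDiff_self hν y (b i) (b i)]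
  field_simp

end Homothety

/-! ### Parabolic scaling of classical and weak set flows of `ℝⁿ⁺¹` -/

section MCF

variable {n : ℕ} {c : ℝ}

/-- Times in the rescaled interval correspond to times in the original one. [folklore] -/
theorem div_sq_mem_Icc (hc : 0 < c) {a b t : ℝ} (ht : t ∈ Icc (c ^ 2 * a) (c ^ 2 * b)) :
    t / c ^ 2 ∈ Icc a b := by
  have hc2 : 0 < c ^ 2 := by positivity
  exact ⟨(le_div_iff₀ hc2).2 (by linarith [ht.1]), (div_le_iff₀ hc2).2 (by linarith [ht.2])⟩

/-- **Mean curvature flow is invariant under parabolic scaling** `(x, t) ↦ (c x, c² t)`, `c > 0`: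
if `(F, ν)` is a classical mean curvature flow on `[a, b]` then `(t, y) ↦ c F(t/c², y)` with
the normal `ν(t/c², y)` is a classical mean curvature flow on `[c² a, c² b]` (`H` scales by `c⁻¹`,
the velocity by `c · c⁻² = c⁻¹`). [cite: Mantegazza2011, §1.1] [folklore] -/
theorem IsClassicalMCF.parabolicSmul (hc : 0 < c) {N : Type*} [TopologicalSpace N]
    [ChartedSpace (EuclideanSpace ℝ (Fin n)) N] [IsManifold (𝓡 n) ∞ N]
    {F : ℝ → N → EuclideanSpace ℝ (Fin (n + 1))} {ν : (t : ℝ) → NormalField (𝓡 (n + 1)) (F t)}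
    {a b : ℝ} (h : IsClassicalMCF (euclideanMetric (EuclideanSpace ℝ (Fin (n + 1)))) F ν a b) :
    IsClassicalMCF (euclideanMetric (EuclideanSpace ℝ (Fin (n + 1))))
      (fun t y ↦ c • F (t / c ^ 2) y) (fun t y ↦ ν (t / c ^ 2) y) (c ^ 2 * a) (c ^ 2 * b) := by
  have hc0 : c ≠ 0 := hc.ne'
  have hc2 : 0 < c ^ 2 := by positivity
  obtain ⟨U, hU, hIU, hF⟩ := h.contMDiffOn
  have hνs : ∀ t ∈ Icc a b, ContMDiff (𝓡 n) 𝓘(ℝ, EuclideanSpace ℝ (Fin (n + 1))) ∞ (ν t) :=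
    fun t ht ↦ (contMDiff_of_contMDiff_lift (h.contMDiff_normal t ht)).2
  have hsp : ∀ t ∈ Icc (c ^ 2 * a) (c ^ 2 * b),
      (euclideanMetric (EuclideanSpace ℝ (Fin (n + 1)))).IsSpacelikeImmersion (𝓡 n)
        (fun y ↦ c • F (t / c ^ 2) y) :=
    fun t ht ↦ isSpacelikeImmersion_const_smul c hc0 (h.isSpacelikeImmersion _ (div_sq_mem_Icc hc ht))
  have hL : ContMDiff 𝓘(ℝ, EuclideanSpace ℝ (Fin (n + 1))) 𝓘(ℝ, EuclideanSpace ℝ (Fin (n + 1))) ∞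
      (fun x : EuclideanSpace ℝ (Fin (n + 1)) ↦ c • x) :=
    (c • ContinuousLinearMap.id ℝ (EuclideanSpace ℝ (Fin (n + 1)))).contMDiff
  have hU' : IsOpen ((fun t : ℝ ↦ t / c ^ 2) ⁻¹' U) := hU.preimage (continuous_id.div_const _)
  refine
    { compactSpace := h.compactSpace
      contMDiffOn := ⟨(fun t : ℝ ↦ t / c ^ 2) ⁻¹' U, hU', fun t ht ↦ hIU (div_sq_mem_Icc hc ht), ?_⟩
      isSpacelikeImmersion := hsp
      injective := fun t ht y₁ y₂ hy ↦
        h.injective _ (div_sq_mem_Icc hc ht) (smul_right_injective _ hc0 hy)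
      isUnitNormal := fun t ht ↦ isUnitNormal_const_smul c
        ((h.isSpacelikeImmersion _ (div_sq_mem_Icc hc ht)).contMDiff_self.of_le (by simp))
        (h.isUnitNormal _ (div_sq_mem_Icc hc ht))
      contMDiff_normal := fun t ht ↦ contMDiff_lift_of_contMDiff
        (hL.comp (h.isSpacelikeImmersion _ (div_sq_mem_Icc hc ht)).contMDiff_self)
        (hνs _ (div_sq_mem_Icc hc ht))
      velocity_eq := fun t ht y ↦ ?_ }
  · -- joint smoothness of the rescaled family
    have hsh : ContMDiff (𝓘(ℝ, ℝ).prod (𝓡 n)) (𝓘(ℝ, ℝ).prod (𝓡 n)) ∞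
        (fun p : ℝ × N ↦ (p.1 / c ^ 2, p.2)) :=
      (contMDiff_fst.div_const _).prodMk contMDiff_snd
    exact hL.comp_contMDiffOn (hF.comp hsh.contMDiffOn fun p hp ↦ ⟨hp.1, mem_univ _⟩)
  · -- velocity: `∂ₜ [c F(t/c², y)] = c · c⁻² ∂ₜF(t/c²) = -(c⁻¹ H) ν = -H' ν`
    have ht' : t / c ^ 2 ∈ Icc a b := div_sq_mem_Icc hc ht
    set s := t / c ^ 2 with hs
    set w : EuclideanSpace ℝ (Fin (n + 1)) := ν s y with hw
    set H₁ : ℝ := (euclideanMetric _).meanCurvature (F s) contMDiff_pullbackBilin_holds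
      (h.isSpacelikeImmersion s ht') (ν s) y with hH₁
    have hslice : HasDerivAt (fun r ↦ F r y) (deriv (fun r ↦ F r y) s) s :=
      hasDerivAt_slice hU hF (hIU ht') y
    have hv : deriv (fun r ↦ F r y) s = (-H₁) • w := by
      rw [← mfderiv_slice_apply_one]
      exact h.velocity_eq s ht' y
    have hresc : HasDerivAt (fun r : ℝ ↦ r / c ^ 2) (c ^ 2)⁻¹ t := by
      simpa [div_eq_mul_inv] using (hasDerivAt_id t).mul_const (c ^ 2)⁻¹
    have hcomp : HasDerivAt (fun r ↦ F (r / c ^ 2) y) ((c ^ 2)⁻¹ • deriv (fun r ↦ F r y) s) t := by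
      have := hslice.scomp t hresc
      exact this
    have hcurve : HasDerivAt (fun r ↦ c • F (r / c ^ 2) y)
        (c • ((c ^ 2)⁻¹ • deriv (fun r ↦ F r y) s)) t := hcomp.const_smul c
    have key : deriv (fun r ↦ c • F (r / c ^ 2) y) t = (-(c⁻¹ * H₁)) • w := by
      rw [hcurve.deriv, hv, smul_smul, smul_smul]
      congr 1
      field_simp
    rw [← mfderiv_slice_apply_one (F := fun r y ↦ c • F (r / c ^ 2) y)] at key
    rw [meanCurvature_const_smul c hc0 contMDiff_pullbackBilin_holds (h.isSpacelikeImmersion s ht')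
      (hsp t ht) (hνs s ht') y]
    exact key

/-- The rescaled time set of `[0, ∞)` is `[0, ∞)`. [folklore] -/
theorem preimage_div_sq_Ici (hc : 0 < c) : (fun r : ℝ ↦ r / c ^ 2) ⁻¹' Ici 0 = Ici 0 := by
  ext r
  simp only [mem_preimage, mem_Ici]
  exact div_nonneg_iff.trans ⟨fun h ↦ by
    rcases h with h | h
    · exact h.1
    · exact absurd h.2 (not_le.2 (by positivity)), fun h ↦ Or.inl ⟨h, by positivity⟩⟩

/-- **Weak set flows are invariant under parabolic scaling**: `t ↦ c · K(t/c²)` is a weak set flow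
on `{t : t/c² ∈ I}` whenever `K` is one on `I` (`c > 0`; test flows rescale by `c⁻¹`).
[cite: HershkovitsWhite2019, Appendix Def. 19] -/
theorem IsWeakSetFlowIn.parabolicSmul (hc : 0 < c) {I : Set ℝ}
    {K : ℝ → Set (EuclideanSpace ℝ (Fin (n + 1)))}
    (hK : IsWeakSetFlowIn (euclideanMetric (EuclideanSpace ℝ (Fin (n + 1)))) univ I K) :
    IsWeakSetFlowIn (euclideanMetric (EuclideanSpace ℝ (Fin (n + 1)))) univ
      ((fun r : ℝ ↦ r / c ^ 2) ⁻¹' I) fun t ↦ (fun x ↦ c • x) '' K (t / c ^ 2) := by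
  have hc0 : c ≠ 0 := hc.ne'
  obtain ⟨-, ⟨C, hC, htr⟩, havoid⟩ := hK
  have hmem : ∀ {x : EuclideanSpace ℝ (Fin (n + 1))} {S : Set (EuclideanSpace ℝ (Fin (n + 1)))},
      x ∈ (fun x ↦ c • x) '' S ↔ c⁻¹ • x ∈ S := fun {x S} ↦
    ⟨fun ⟨y, hy, hyx⟩ ↦ by
        rw [← hyx]; show c⁻¹ • (c • y) ∈ S; rw [smul_smul, inv_mul_cancel₀ hc0, one_smul]; exact hy,
      fun h ↦ ⟨c⁻¹ • x, h, by show c • (c⁻¹ • x) = x; rw [smul_smul, mul_inv_cancel₀ hc0, one_smul]⟩⟩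
  refine ⟨fun t _ ↦ subset_univ _,
    ⟨(fun p : EuclideanSpace ℝ (Fin (n + 1)) × ℝ ↦ (c⁻¹ • p.1, p.2 / c ^ 2)) ⁻¹' C,
      hC.preimage ((continuous_fst.const_smul c⁻¹).prodMk (continuous_snd.div_const (c ^ 2))), ?_⟩, ?_⟩
  · ext ⟨x, t⟩
    have key := Set.ext_iff.1 htr (c⁻¹ • x, t / c ^ 2)
    simp only [mem_setOf_eq, mem_inter_iff, mem_prod, mem_univ, true_and, mem_preimage] at key ⊢
    rw [hmem]
    exact key
  · intro a' b' hab' hI' N' _ _ _ F' ν' hF' _ hdis t ht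
    -- pull the test flow back: `r ↦ c⁻¹ F'(c² r)` on `[a'/c², b'/c²]`
    have hci : 0 < c⁻¹ := inv_pos.2 hc
    have hflow := hF'.parabolicSmul hci
    have hsq : ∀ r : ℝ, r / c⁻¹ ^ 2 = c ^ 2 * r := fun r ↦ by field_simp
    have ha : c⁻¹ ^ 2 * a' = a' / c ^ 2 := by field_simp
    have hb : c⁻¹ ^ 2 * b' = b' / c ^ 2 := by field_simp
    rw [ha, hb] at hflow
    have hI'' : Icc (a' / c ^ 2) (b' / c ^ 2) ⊆ I := fun r hr ↦ by
      have h1 : c ^ 2 * r ∈ Icc a' b' :=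
        ⟨by have := hr.1; rwa [div_le_iff₀ (by positivity), mul_comm] at this,
         by have := hr.2; rwa [le_div_iff₀ (by positivity), mul_comm] at this⟩
      have h2 := hI' h1
      simp only [mem_preimage] at h2
      rwa [mul_div_cancel_left₀ _ (by positivity)] at h2
    have hdis' : Disjoint (range fun y ↦ c⁻¹ • F' (a' / c ^ 2 / c⁻¹ ^ 2) y) (K (a' / c ^ 2)) := by
      refine Set.disjoint_left.2 ?_
      rintro _ ⟨y, rfl⟩ hm
      rw [hsq, mul_div_cancel₀ _ (by positivity)] at hm
      exact Set.disjoint_left.1 hdis (mem_range_self y) (hmem.2 hm)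
    have ht'' : t / c ^ 2 ∈ Icc (a' / c ^ 2) (b' / c ^ 2) :=
      ⟨div_le_div_of_nonneg_right ht.1 (by positivity), div_le_div_of_nonneg_right ht.2 (by positivity)⟩
    have key := havoid (div_le_div_of_nonneg_right hab' (by positivity)) hI'' N'
      (fun r y ↦ c⁻¹ • F' (r / c⁻¹ ^ 2) y) (fun r y ↦ ν' (r / c⁻¹ ^ 2) y) hflow
      (fun _ _ ↦ subset_univ _) hdis' (t / c ^ 2) ht''
    refine Set.disjoint_left.2 ?_
    rintro _ ⟨y, rfl⟩ hm
    refine Set.disjoint_left.1 key (mem_range_self y) ?_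
    show c⁻¹ • F' (t / c ^ 2 / c⁻¹ ^ 2) y ∈ K (t / c ^ 2)
    rw [hsq, mul_div_cancel₀ _ (by positivity)]
    exact hmem.1 hm

/-- **The level set flow commutes with parabolic scaling**: `F_t(c K₀) = c F_{t/c²}(K₀)` for
`c > 0` (uniqueness of the biggest flow). [cite: White2000, §2] -/
theorem levelSetFlow_image_smul (hc : 0 < c) (K₀ : Set (EuclideanSpace ℝ (Fin (n + 1)))) (t : ℝ) :
    levelSetFlow (euclideanMetric (EuclideanSpace ℝ (Fin (n + 1)))) ((fun x ↦ c • x) '' K₀) t =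
      (fun x ↦ c • x) '' levelSetFlow (euclideanMetric (EuclideanSpace ℝ (Fin (n + 1)))) K₀ (t / c ^ 2) := by
  -- one inclusion for every scale `μ > 0`
  have half : ∀ {μ : ℝ}, 0 < μ → ∀ (K₁ : Set (EuclideanSpace ℝ (Fin (n + 1)))) (s : ℝ),
      (fun x ↦ μ • x) '' levelSetFlow (euclideanMetric (EuclideanSpace ℝ (Fin (n + 1)))) K₁ s ⊆
        levelSetFlow (euclideanMetric (EuclideanSpace ℝ (Fin (n + 1)))) ((fun x ↦ μ • x) '' K₁)
          (μ ^ 2 * s) := by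
    intro μ hμ K₁ s
    rintro _ ⟨x, ⟨hs, K, hK, hK0, hxK⟩, rfl⟩
    have hweak := (hK.parabolicSmul hμ)
    rw [preimage_div_sq_Ici hμ] at hweak
    refine subset_levelSetFlow hweak ?_ (by positivity : 0 ≤ μ ^ 2 * s) ?_
    · show (fun x ↦ μ • x) '' K (0 / μ ^ 2) ⊆ (fun x ↦ μ • x) '' K₁
      rw [zero_div]; exact image_mono hK0
    · show μ • x ∈ (fun x ↦ μ • x) '' K (μ ^ 2 * s / μ ^ 2)
      rw [mul_div_cancel_left₀ _ (by positivity)]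
      exact mem_image_of_mem _ hxK
  have hc0 : c ≠ 0 := hc.ne'
  refine Subset.antisymm ?_ ?_
  · intro x hx
    have h := half (inv_pos.2 hc) ((fun x ↦ c • x) '' K₀) t (mem_image_of_mem _ hx)
    have hK : (fun x ↦ c⁻¹ • x) '' ((fun x ↦ c • x) '' K₀) = K₀ := by
      rw [← image_comp]
      have hid : ((fun x : EuclideanSpace ℝ (Fin (n + 1)) ↦ c⁻¹ • x) ∘ fun x ↦ c • x) = id :=
        funext fun y ↦ by simp [smul_smul, inv_mul_cancel₀ hc0]
      rw [hid, image_id]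
    rw [hK, show c⁻¹ ^ 2 * t = t / c ^ 2 by field_simp] at h
    exact ⟨c⁻¹ • x, h, by show c • (c⁻¹ • x) = x; rw [smul_smul, mul_inv_cancel₀ hc0, one_smul]⟩
  · have h := half hc K₀ (t / c ^ 2)
    rwa [mul_div_cancel₀ _ (by positivity)] at h

/-- **Self-similarly scaled copies of a set have rescaled level set flows**; in particular for
`K₀` a cone (`c K₀ = K₀` for all `c > 0`) the flow is self-similar: `F_{c²t}(K₀) = c F_t(K₀)`.
[cite: White2000, §2] -/
theorem levelSetFlow_cone (hc : 0 < c) {K₀ : Set (EuclideanSpace ℝ (Fin (n + 1)))}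
    (hK₀ : (fun x ↦ c • x) '' K₀ = K₀) (t : ℝ) :
    levelSetFlow (euclideanMetric (EuclideanSpace ℝ (Fin (n + 1)))) K₀ (c ^ 2 * t) =
      (fun x ↦ c • x) '' levelSetFlow (euclideanMetric (EuclideanSpace ℝ (Fin (n + 1)))) K₀ t := by
  have h := levelSetFlow_image_smul hc K₀ (c ^ 2 * t)
  rwa [hK₀, mul_div_cancel_left₀ _ (by positivity)] at h

end MCF

end Literature.Geometry.Riemannian

end
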